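import Mathlib
import HarnessLib
import Summits.Ventures.LatticeQCDFlow.Exactness.PseudoMarginalFlowSampler
import Summits.Ventures.LatticeQCDFlow.Exactness.FlowSamplerFluxSymmetricAcceptance

/-!
# Screen with the gauge action, pay for the determinant only on survivors, use a STOCHASTIC determinant estimate: delayed acceptance on the
# pseudo-marginal flow sampler is exact, on a general state space

HONEST FRAMING: exact (Metropolis-corrected) sampling algorithms for lattice gauge theory;
figures of merit are autocorrelation/cost numbers at stated couplings and volumes; no
continuum-physics claim.

Venture `LatticeQCDFlow` (cell pub-lqcd), topic `Exactness`; FANOUT row 30 (lean-1, GEN-42).  NEW WORK of the cell: the composition of this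
generation's `PseudoMarginalFlowSampler` (extended target `π̂ = ŵ·(q ⊗ₘ κ)` with configuration marginal `π = w·q`) and
`FlowSamplerFluxSymmetricAcceptance` (delayed acceptance with an arbitrary positive surrogate is exact for every accept/reject kernel of its
form) on the extended space `Ω × U`, with a surrogate `w₁(x)` that reads the CONFIGURATION only (no noise needed to evaluate it: the pure-gauge
weight `e^{−S_g}/q̃`, or any cheap positive function).  DEF-FREE: the run is any Markov kernel `K` on `Ω × U` proposing `(y, u') ∼ q ⊗ₘ κ`
and accepting with `min(1, w₁(y)/w₁(x))·min(1, ŵ(y, u')w₁(x)/(ŵ(x, u)w₁(y)))` — stage 1 never touches the noise, stage 2 draws the fresh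
estimate only for stage-1 survivors.

## Results (no `sorry`, no new definitions)
* `pmda_flux_symm` — flux symmetry of the two-stage rule on `Ω × U` with the weight ESTIMATE in stage 2; `pmda_le_one`, `measurable_pmda`.
* **`pmda_isReversible`** — the run is reversible for `π̂` and leaves it invariant, FOR EVERY flow `q`, noise law `κ`, positive estimate `ŵ` and
  positive surrogate `w₁`; **`pmda_configuration_exact`** — with `ŵ` unbiased for `w`: `((π̂K).map fst) = π`, the configuration law after a step
  from `π̂` is exactly `π = w·q`.
* **`pmda_le_pm`** — its acceptance never exceeds the one-stage pseudo-marginal acceptance `min(1, ŵ(y, u')/ŵ(x, u))` (pointwise), and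
  **`pmda_ge_pm_exp`** — a surrogate within `δ` of the estimate's log-ratio keeps at least `e^{−δ}` of it.
Reading (gauge files with fermions): propose `U'` from the flow; accept provisionally with the pure-gauge ratio; only then draw pseudofermions and
test `min(1, est(U')·g(U)/(est(U)·g(U')))` with the recycled estimate of the current state; the sampled gauge law is exactly
`∝ e^{−S_g} det D`.  NOT CLAIMED: the cost saved (depends on the stage-1 rejection rate `1 − E_q[min(1, w₁(y)/w₁(x))]`, not bounded here).
-/

noncomputable section

namespace Summit.Ventures.LatticeQCDFlow.Exactness

open MeasureTheory ProbabilityTheory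
open scoped ENNReal

variable {Ω U : Type*} [MeasurableSpace Ω] [MeasurableSpace U]
  {q : Measure Ω} [IsProbabilityMeasure q] {κ : Kernel Ω U} [IsMarkovKernel κ]
  {w w₁ : Ω → ℝ} {west : Ω × U → ℝ}

omit [MeasurableSpace Ω] [MeasurableSpace U] in
/-- Flux symmetry of the two-stage rule on the extended space: the surrogate reads the configuration, stage 2 the estimate. [ours — instance of
`delayedAcceptance_flux_symm` with weight `ŵ` and surrogate `w₁ ∘ fst`] -/
theorem pmda_flux_symm (hW0 : ∀ z, 0 < west z) (hw₁ : ∀ x, 0 < w₁ x) (z z' : Ω × U) :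
    ENNReal.ofReal (west z) * ENNReal.ofReal (min 1 (w₁ z'.1 / w₁ z.1) * min 1 (west z' * w₁ z.1 / (west z * w₁ z'.1))) =
      ENNReal.ofReal (west z') * ENNReal.ofReal (min 1 (w₁ z.1 / w₁ z'.1) * min 1 (west z * w₁ z'.1 / (west z' * w₁ z.1))) :=
  delayedAcceptance_flux_symm (w := west) (w₁ := fun z : Ω × U => w₁ z.1) hW0 (fun z => hw₁ z.1) z z'

omit [MeasurableSpace Ω] [MeasurableSpace U] in
/-- The two-stage rule is a probability. [ours] -/
theorem pmda_le_one (hW0 : ∀ z, 0 < west z) (hw₁ : ∀ x, 0 < w₁ x) (z z' : Ω × U) :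
    ENNReal.ofReal (min 1 (w₁ z'.1 / w₁ z.1) * min 1 (west z' * w₁ z.1 / (west z * w₁ z'.1))) ≤ 1 :=
  delayedAcceptance_le_one (w := west) (w₁ := fun z : Ω × U => w₁ z.1) hW0 (fun z => hw₁ z.1) z z'

/-- The two-stage rule is jointly measurable on `(Ω × U) × (Ω × U)`. [ours] -/
theorem measurable_pmda (hW : Measurable west) (hw₁m : Measurable w₁) :
    Measurable (Function.uncurry fun z z' : Ω × U => ENNReal.ofReal (min 1 (w₁ z'.1 / w₁ z.1) * min 1 (west z' * w₁ z.1 / (west z * w₁ z'.1)))) :=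
  measurable_delayedAcceptance (w := west) (w₁ := fun z : Ω × U => w₁ z.1) hW (hw₁m.comp measurable_fst)

/-- **DELAYED ACCEPTANCE ON THE PSEUDO-MARGINAL FLOW SAMPLER IS EXACT**: any Markov kernel on `Ω × U` that proposes `(y, u') ∼ q ⊗ₘ κ`,
accepts with `min(1, w₁(y)/w₁(x))·min(1, ŵ(y, u')w₁(x)/(ŵ(x, u)w₁(y)))` and otherwise keeps `(x, u)` is reversible for `π̂ = ŵ·(q ⊗ₘ κ)` and
leaves it invariant — for every flow, noise law, positive estimate and positive surrogate. [ours] -/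
theorem pmda_isReversible (hW : Measurable west) (hW0 : ∀ z, 0 < west z) (hw₁m : Measurable w₁) (hw₁ : ∀ x, 0 < w₁ x)
    (K : Kernel (Ω × U) (Ω × U)) [IsMarkovKernel K]
    (hK : ∀ (z : Ω × U) {B : Set (Ω × U)}, MeasurableSet B → K z B =
      ∫⁻ z' in B, ENNReal.ofReal (min 1 (w₁ z'.1 / w₁ z.1) * min 1 (west z' * w₁ z.1 / (west z * w₁ z'.1))) ∂(q ⊗ₘ κ) +
        (1 - ∫⁻ z', ENNReal.ofReal (min 1 (w₁ z'.1 / w₁ z.1) * min 1 (west z' * w₁ z.1 / (west z * w₁ z'.1))) ∂(q ⊗ₘ κ)) * B.indicator 1 z) :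
    Kernel.IsReversible K ((q ⊗ₘ κ).withDensity fun z => ENNReal.ofReal (west z)) ∧
      Kernel.Invariant K ((q ⊗ₘ κ).withDensity fun z => ENNReal.ofReal (west z)) :=
  delayedAcceptance_isReversible (q := q ⊗ₘ κ) (w := west) (w₁ := fun z : Ω × U => w₁ z.1) hW hW0 (hw₁m.comp measurable_fst)
    (fun z => hw₁ z.1) K hK

/-- **… AND ITS CONFIGURATION LAW IS EXACTLY `π`**: with `ŵ` unbiased for `w`, one step from `π̂` leaves the configuration distributed as `π = w·q`.
[ours] -/
theorem pmda_configuration_exact (hW : Measurable west) (hW0 : ∀ z, 0 < west z) (hw₁m : Measurable w₁) (hw₁ : ∀ x, 0 < w₁ x)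
    (hunb : ∀ x, ∫⁻ u, ENNReal.ofReal (west (x, u)) ∂(κ x) = ENNReal.ofReal (w x))
    (K : Kernel (Ω × U) (Ω × U)) [IsMarkovKernel K]
    (hK : ∀ (z : Ω × U) {B : Set (Ω × U)}, MeasurableSet B → K z B =
      ∫⁻ z' in B, ENNReal.ofReal (min 1 (w₁ z'.1 / w₁ z.1) * min 1 (west z' * w₁ z.1 / (west z * w₁ z'.1))) ∂(q ⊗ₘ κ) +
        (1 - ∫⁻ z', ENNReal.ofReal (min 1 (w₁ z'.1 / w₁ z.1) * min 1 (west z' * w₁ z.1 / (west z * w₁ z'.1))) ∂(q ⊗ₘ κ)) * B.indicator 1 z) :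
    (((q ⊗ₘ κ).withDensity fun z => ENNReal.ofReal (west z)).bind K).map Prod.fst = q.withDensity fun x => ENNReal.ofReal (w x) := by
  have h : ((q ⊗ₘ κ).withDensity fun z => ENNReal.ofReal (west z)).bind K = (q ⊗ₘ κ).withDensity fun z => ENNReal.ofReal (west z) :=
    (pmda_isReversible hW hW0 hw₁m hw₁ K hK).2
  rw [h, pseudoMarginal_target_map_fst hW hunb]

omit [MeasurableSpace Ω] [MeasurableSpace U] in
/-- **Screening never raises the acceptance** above the one-stage pseudo-marginal rule `min(1, ŵ(z')/ŵ(z))`. [ours] -/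
theorem pmda_le_pm (hW0 : ∀ z, 0 < west z) (hw₁ : ∀ x, 0 < w₁ x) (z z' : Ω × U) :
    min 1 (w₁ z'.1 / w₁ z.1) * min 1 (west z' * w₁ z.1 / (west z * w₁ z'.1)) ≤ imhAccept west z z' :=
  delayedAcceptance_le_imhAccept (w := west) (w₁ := fun z : Ω × U => w₁ z.1) hW0 (fun z => hw₁ z.1) z z'

omit [MeasurableSpace Ω] [MeasurableSpace U] in
/-- **… and a surrogate within `δ` of the estimate's log-ratio keeps at least the fraction `e^{−δ}` of it.** [ours] -/
theorem pmda_ge_pm_exp (hW0 : ∀ z, 0 < west z) (hw₁ : ∀ x, 0 < w₁ x) (z z' : Ω × U) {δ : ℝ}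
    (hlo : Real.exp (-δ) ≤ (west z' / west z) / (w₁ z'.1 / w₁ z.1)) (hhi : (west z' / west z) / (w₁ z'.1 / w₁ z.1) ≤ Real.exp δ) :
    Real.exp (-δ) * imhAccept west z z' ≤ min 1 (w₁ z'.1 / w₁ z.1) * min 1 (west z' * w₁ z.1 / (west z * w₁ z'.1)) :=
  delayedAcceptance_ge_exp (w := west) (w₁ := fun z : Ω × U => w₁ z.1) hW0 (fun z => hw₁ z.1) z z' hlo hhi

end Summit.Ventures.LatticeQCDFlow.Exactness
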